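import Mathlib
import HarnessLib
import HarnessLib.Audit
import Summits.AnomalousDissipation.Statement
import Literature.Analysis.FunctionSpaces.TorusTrigPoly
import Literature.Analysis.FluidPDE.EulerReynolds

/-!
Route: TaylorResolutionBarrier

CLOSED (retired) 2026-08-15T13:38:20Z by operator:999:1257524 — reason: not-a-thesis: assembly does not conclude the sub-problem Statement — note: D-0027 §2.1 audit (human 2026-08-15: routes that do not decide the summit are removed): the assembly concludes `TaylorBarrier`, not the sub-problem statement; a NEW conforming route may be opened from the same idea (generated `closes : … → _root_.AnomalousDissipation`).. The file is kept as the record of this route; refuted decls are indexed as negative knowledge (`ledger negatives`).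

BARRIER ROUTE (D-0021 negative knowledge), realising idea card
taylor-resolution-barrier-certificates. It is declared up front that X does NOT imply
Summit.AnomalousDissipation and is not claimed to: X is a no-go theorem for a technique class,
provable now from tree facts; the Assembly item is the glue DivFreeBath → CertificateIdentity →
TaylorBarrier (conclusion = the barrier), and the deliverable is a Theorems file that a literature
seat can vendor as Literature/Barriers/AnomalousDissipation/TaylorResolutionCertificates
(technique_class: energy-cylindrical phase-space certificates of resolution o(ν^{-1/2})).

## Thesis X (words)
"It suffices to show X" = TaylorBarrier (Taylor-microscale resolution barrier, adversary form).
Technique class: ν-indexed PHASE-SPACE CERTIFICATES for a dissipation/injection floor —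
auxiliary/Lyapunov/SOS functionals V_ν(u) = Ψ_ν(P_N u, ‖u‖²) of finitely many resolved Fourier modes
and the total (equivalently the unresolved) energy, exactly the class V(a, q²) of
Goulart–Chernyshenko (arXiv:1101.1043 §§4–5; review ChernyshenkoEtAl2014) and of cards
kolmogorov-floor-certificates / covariant-certificates-scale-induction-loglattice — required to
satisfy, for ALL smooth divergence-free mean-zero u,  (C)  ν‖∇u‖² + ⟨−(u·∇)u + νΔu + f, DV_ν(u)⟩ ≥
Φ(u)  with a floor Φ ≥ φ₀ > 0 on the energy sphere ‖u‖² = E'. At states with P_N u = 0, ‖u‖² = E'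
one has DV_ν(u) = W + 2θu with W = ∇_aΨ_ν(0,E') a divergence-free field of Fourier degree ≤ N and θ
= ∂_eΨ_ν(0,E') (W + 2θu divergence free, so the Leray projector drops). X: for every smooth
divergence-free mean-zero force f on T³, every bath datum (c₀ > 0 and a smooth symmetric tensor S
with |S_ij| ≤ c₀/10 and div S = f; bath energy E' = 3c₀ + ∫ tr S), every floor φ₀ > 0 and bound Θ,
there are c, ν₀ > 0 such that for 0 < ν < ν₀, |θ| ≤ Θ, every N ≤ c ν^{-1/2} and every
divergence-free W of degree ≤ N with sup|∂_jW| ≤ c ν⁻¹ there is a smooth divergence-free mean-zero u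
with P_N u = 0, ‖u‖² = E' and ν‖∇u‖² + ⟨−(u·∇)u + νΔu + f, W + 2θu⟩ < φ₀. Contrapositive: a
ν-uniform floor certificate of this class must resolve ≳ ν^{-1/2} modes (the Taylor-microscale
wavenumber, λ_T² = 15νU²/ε) or carry gradients ≳ ν⁻¹ at the quiet state — polynomial DEGREE is
irrelevant, RESOLUTION is forced. The adversary is a De Lellis–Székelyhidi bath: localised
divergence-free plane waves realising the stress R = c₀ Id + S (div R = f) weakly, parked above the
certificate's resolution and below the viscous pricing scale n ≍ ν^{-1/2}; it draws no power ((f,u)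
→ 0) yet its Reynolds stress cancels (f, W) exactly.

## Thesis X (Lean, one line; elaborates — folder Sketch.lean rc 0; decl TaylorBarrier of this file)
∀ f, Torus.IsSmooth f → Torus.IsDivFree f → Torus.HasZeroMean f → ∀ c₀ S, 0 < c₀ → Torus.IsSmooth S
→ (∀ x i j, S x i j = S x j i) → (∀ x i j, |S x i j| ≤ c₀/10) → (∀ x,
FluidPDE.Torus.tensorDivergence S x = f x) → ∀ φ₀ Θ, 0 < φ₀ → ∃ c > 0, ∃ ν₀ > 0, ∀ ν θ N W, 0 < ν →
ν < ν₀ → |θ| ≤ Θ → Torus.IsDivFree W → Torus.fourierTruncate N W = W → (N:ℝ) ≤ c·ν^(-1/2) → (∀ x j,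
‖Torus.partialDeriv j W x‖ ≤ c·ν⁻¹) → ∃ u, Torus.IsSmooth u ∧ Torus.IsDivFree u ∧ Torus.HasZeroMean
u ∧ Torus.fourierTruncate N u = 0 ∧ ∫‖u‖² = 3c₀ + ∫ Σᵢ S x i i ∧ ν·Torus.gradNormSq u +
∫⟪−Torus.convect u u x + ν•Torus.laplacian u x + f x, W x + (2θ)•u x⟫ < φ₀   (all constants exist:
Literature.Analysis.FunctionSpaces.Torus.{IsSmooth,IsDivFree,HasZeroMean,fourierTruncate,partialDeriv,convect,laplacian,gradNormSq},
Literature.Analysis.FluidPDE.Torus.tensorDivergence).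

## Assembly
DivFreeBath → CertificateIdentity → TaylorBarrier (arithmetic recorded on the Assembly item). NOT an
implication to the summit.

UNDER FLOOR: fewer than 2 cruxes remain after retriage (legacy route; D-0019).

Rationale: WHY THIS LINE (imports: convex-integration relaxation × certificate/measure duality; menu items 1
and 25 read backwards). Two live cards propose CERTIFICATES for the zeroth law
(kolmogorov-floor-certificates: ν-indexed cubic functionals of P_{N(ν)}u, SOS-searchable;
covariant-certificates-scale-induction-loglattice), and every ν-uniform body-force bound in print is
a degree-2 functional of this kind (DoeringFoias2002; GoulartChernyshenko2012 §§4–5 V(a,q²);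
ChernyshenkoEtAl2014). This route proves, now, how deep such a certificate must look: the weak
closure of {u⊗u : div u = 0} is the PSD cone, realised by localised divergence-free plane waves
(LellisSzekelyhidi2009 = arXiv:math/0702079 §4) whose amplitudes come from the Nash geometric lemma
PROVED in the tree (Literature.Analysis.FluidPDE.NashGeometric.geometric_lemma, CheskidovLuo2022
Lemma 4.2); a bath at frequency n ≍ ν^{-1/2} carrying the stress c₀Id + S with div S = f cancels the
certificate's only lever (f, W) exactly while viscosity prices it at ν n² E' = O(c'²) and the floor
φ₀ stays. Genre precedent: NobiliOtto2017 (a barrier against the background-field certificate class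
via a structured adversary). Planner's sharpening of the card: against test tensors of degree ≤ n/8
every oscillatory cross term is EXACTLY orthogonal, so the stress defect is O(K/n²) and the
thresholds are N ≳ ν^{-1/2} OR sup|∇W| ≳ ν⁻¹ (card: ν^{-1/2} in C²).
RANKED CRUXES. #2 DivFreeBath (hardest: exact energy, exact vanishing of all modes |k| ≤ n, ‖∇u‖² ≤
Cn², and the O(K/n²) stress defect against divergence-free degree-≤n/8 tensors, all at once). #3
CertificateIdentity (the certificate left side at a bath state is explicit: (1−2θ)ν‖∇u‖² +
[∫(u⊗u):∇W − ∫S:∇W] + 2θ(f,u); conventions of Torus.convect/laplacian and the spectral step ⟪Δu,W⟫ =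
0). Target #0 TaylorBarrier; Assembly #1 = DivFreeBath → CertificateIdentity → TaylorBarrier (pure
bookkeeping: n = ⌊c'ν^{-1/2}⌋, c = min(c'/16, φ₀c'²/16C), tail 2Θ‖f − T_n f‖₂√E'). Support:
BathDataAboveThreshold (S₀ = ∇Δ⁻¹f + (∇Δ⁻¹f)ᵀ, E ≥ 30 sup|S₀|), the energy window on which the
barrier bites.
KILL CRITERIA. DivFreeBath refuted with defect provably ≥ cK/n for every annulus-localised bath ⇒
restate TaylorBarrier with ν^{-1/2} amplitude threshold (the card's form), not close; a proof that
SOME energy-cylindrical certificate with N(ν) = o(ν^{-1/2}) certifies a ν-uniform floor above E₀(f)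
refutes TaylorBarrier and closes the route (and would be major positive news for
kolmogorov-floor-certificates).
NOT DECOMPOSED YET. The BASED version (bath on top of a quiet low-mode state a: residual
(1−2θ_a)ν‖∇a‖² + 2θ_a(f,a) + o(1), conditional); the sharp LP window (E_rel(f), ∞) of card
second-moment-horizon (needs Nash's lemma on arbitrary compact subsets of the PD cone, not in tree);
enstrophy-dependent functionals (honestly OUTSIDE the barrier: the bath's own vortex stretching
enters with unknown sign); the computational corollary for the SDP leg (β_SDP(ν;N) ≈ 0 for ν <
c/N²).
NOVELTY. See route Novelty field: nearest prior art searched 2026-08-15 (crossref: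
GoulartChernyshenko2012 read pp.11–13 via lit read arXiv:1101.1043; doi:10.1098/rspa.2015.0622;
ChernyshenkoEtAl2014; NobiliOtto2017; zbMATH 'Goluskin Fantuzzi' → arXiv:1907.10997; lit search
--hybrid/vsearch local: FMRT2001, ConstantinFoias1988, DoeringGibbon1995 pages, nothing on
resolution lower bounds; lit frontier/bridges: convex-integration descendants only;
galaxy/openalex/s2 unavailable (75/429) this session). Card graded new-combination twice
(refuter-novelty-audit-…-2-0 and …-10-0, 2026-08-15).
BARRIERS. See route Barriers field (technique_class tokens meet no catalogued class;
BuckmasterVicol2019_thm13 is the adversary's toolbox, Cheskidov2023_thm13 is the complementary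
direction).

Novelty: Nearest prior art (searched 2026-08-15; crossref + local hybrid/vsearch + lit frontier/bridges;
galaxy/OpenAlex/S2 unavailable this session): (i) the technique class in print —
GoulartChernyshenko2012 = doi:10.1016/j.physd.2011.12.008 = arXiv:1101.1043 §§4–5 (READ pp.11–13:
Lyapunov functionals V(a,q²) of the resolved Galerkin modes a and the unresolved energy q², SOS
search; the tail enters only through its energy) and the review ChernyshenkoEtAl2014 =
doi:10.1098/rsta.2013.0350, doi:10.1098/rspa.2015.0622; (ii) certificate/invariant-measure duality
arXiv:1705.07096 (Tobasco–Goluskin–Doering), arXiv:2010.06730 (Rosa–Temam; sharp only on compact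
carriers), pointwise dual relaxations certify only relaxed problems arXiv:2110.03079; (iii) the
adversary's toolbox arXiv:math/0702079 §4 (De Lellis–Székelyhidi: div-free plane-wave localisation,
PSD hull) with the Nash geometric lemma (CheskidovLuo2022 = arXiv:2009.06596 Lemma 4.2, PROVED in
tree); (iv) genre precedent NobiliOtto2017 = doi:10.1063/1.5002559 (barrier theorem against a
certificate class by a structured adversary, RB convection). Not found anywhere: a resolution lower
bound for ν-uniform dissipation-floor certificates of forced NS. Delta (new-combination, card
audited twice): DLS oscillatory baths carrying a stress with div S = f, parked strictly between the
certificate's Fourier resolution N and the viscous pricing scale n ≍ ν^{-1/2}, defeat every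
energy-cylindrical certificate with N ≤ cν^{-1/2} and sup|∇W| ≤ cν⁻¹; pl  [refs: 10.1016/j.physd.2011.12.008, 10.1098/rsta.2013.0350, 10.1098/rspa.2015.0622, 10.1063/1.5002559, 1101.1043, 1705.07096, 2010.06730, 2110.03079, math/0702079, 2009.06596, doi:10.1016/j.physd.2011.12.008, doi:10.1098/rsta.2013.0350, doi:10.1098/rspa.2015.0622, doi:10.1063/1.5002559, GoulartChernyshenko2012, ChernyshenkoEtAl2014, CheskidovLuo2022, NobiliOtto2017]

Barriers (technique_class: barrier-theorem auxiliary-functional sum-of-squares): technique_class: barrier-theorem auxiliary-functional sum-of-squares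
- Literature.Barriers.AnomalousDissipation.BuckmasterVicol2019_thm13: not met — convex integration
is USED as the adversary's toolbox (Nash decomposition + localised divergence-free plane waves); no
Leray–Hopf realisation is needed because bath states are test points of a phase-space inequality,
not solutions of anything.
- Literature.Barriers.AnomalousDissipation.Cheskidov2023_thm13_not_forceRobustNoAnomaly: opposite
direction — it blocks force-robust NO-anomaly proofs (route Neg); this route blocks coarse ANOMALY
certificates; complementary, no token shared (technique_class here: barrier-theorem
auxiliary-functional sum-of-squares).
- Literature.Barriers.AnomalousDissipation.Cheskidov2023_thm21_noDissipationAnomaly: consistent —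
the bath is the stationary phase-space caricature of energy escaping to unresolved scales without
being priced by viscosity; nothing to evade.
- Literature.Barriers.AnomalousDissipation.AlexakisDoering2006_energyDissipationBound: 2-D only;
there a ν-uniform floor certificate cannot exist at all (ε_2D = O(Re^{-1/2})), consistent with and
weaker than X; the route is on T³.
- Literature.Barriers.AnomalousDissipation.Marchioro1986_globalAttraction: first-shell forcing is
laminar; X is uniform in f and says nothing about which f admit certificates — n/a.
- Literature.Barriers.AnomalousDissipation.DrivasEyink2019_lemma1_measurable,
Literature.Barriers.AnomalousDissipation.DeRosaIsett2024

History (route lifecycle, newest last):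
- 2026-08-15T13:38:20Z · CLOSED retired — not-a-thesis: assembly does not conclude the sub-problem Statement (operator:999:1257524)

sub-problem: AnomalousDissipation · status: closed(retired) · opened planner-plancard-AnomalousDissipation-Anomalo-d143ac11-0 2026-08-15T10:53:55Z · rev 1 · ledger route-AnomalousDissipation-TaylorResolutionBarrier
GENERATED by the gate from the ledger (D-0016/17). Provers cite these decls: `theorem foo : Summit.AnomalousDissipation.AnomalousDissipation.Theses.TaylorResolutionBarrier.<Decl> := …` in Summits/AnomalousDissipation/AnomalousDissipation/Theorems/<Name>.lean.
-/

namespace Summit.AnomalousDissipation.AnomalousDissipation.Theses.TaylorResolutionBarrier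

open scoped BigOperators Topology Manifold Classical MeasureTheory ProbabilityTheory Matrix InnerProductSpace ComplexConjugate ContinuousMap
open Filter Set Function TopologicalSpace MeasureTheory

attribute [summit_statement] _root_.AnomalousDissipation

open Literature.Turb

/-- item stmt-AnomalousDissipation-1239 · target · rank 0 · closed · moot by None · by planner
why it might fail: Inherited only: TaylorBarrier = DivFreeBath via CertificateIdentity + arithmetic (n=⌊c′ν^{-1/2}⌋, 8N≤n, K=cν⁻¹ ⇒ CK/n² ≤ 4Cc/c′²). If baths give only an O(K/n) defect, the cν⁻¹ gradient threshold is too strong by ν^{-1/2} (card's cν^{-1/2} form) ⇒ restate, not close. No independent failure mode.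
sources: arXiv:math/0702079 Prop. 2.2 + §3 (De Lellis–Székelyhidi localized plane waves; read p.5-6) and §4.1 Lemmas 4.2-4.3 (K^co, wave-cone segments; read p.8-9), GoulartChernyshenko2012 = arXiv:1101.1043 §§4-5 pp.11-13 (V(a,q²) energy-cylindrical certificates), NobiliOtto2017 = doi:10.1063/1.5002559 (genre precedent: barrier against a certificate class), ChernyshenkoEtAl2014 = doi:10.1098/rsta.2013.0350; arXiv:2010.06730 (Rosa–Temam duality), tree (assembly ingredients, proved): Literature.Analysis.FunctionSpaces.Torus.tendsto_eLpNorm_fourierTruncate_sub, integral_inner_fourierTruncate_eq, freqBall_mono, mFourierCoeff_realTrigPoly_eq_zero, idea card Summits/AnomalousDissipation/AnomalousDissipation/Ideas/taylor-resolution-barrier-certificates.md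
[target] Taylor-microscale resolution barrier, adversary form. For f smooth div-free mean-zero on T³
and a bath datum (c₀>0, S smooth symmetric, |S_ij| ≤ c₀/10, div S = f; bath energy E' = 3c₀ + ∫tr
S), floor φ₀>0 and bound Θ: ∃ c, ν₀ > 0 s.t. for 0<ν<ν₀, |θ|≤Θ, any resolution N ≤ c ν^{-1/2} and
any div-free W of Fourier degree ≤ N (fourierTruncate N W = W) with sup‖∂_jW‖ ≤ c ν⁻¹, some smooth
div-free mean-zero u with P_N u = 0, ‖u‖²₂ = E' has ν‖∇u‖² + ∫⟪−(u·∇)u + νΔu + f, W + 2θu⟫ < φ₀.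
Here W = ∇_aΨ_ν(0,E'), θ = ∂_eΨ_ν(0,E') for an energy-cylindrical certificate V_ν(u) = Ψ_ν(P_N u,
‖u‖²) (Goulart–Chernyshenko V(a,q²), arXiv:1101.1043 §5; card kolmogorov-floor-certificates (C_ν));
the Leray projector drops because W + 2θu is divergence free. Contrapositive = the barrier:
ν-uniform floor certificates of this class need N ≳ ν^{-1/2} (Taylor wavenumber) or ‖∇DV_ν(0,E')‖_∞
≳ ν⁻¹. BARRIER ROUTE: this is the thesis X; it does not imply the summit. -/
@[route_item "route-AnomalousDissipation-TaylorResolutionBarrier"]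
def TaylorBarrier : Prop :=
  ∀ f : UnitAddTorus (Fin 3) → EuclideanSpace ℝ (Fin 3), Literature.Analysis.FunctionSpaces.Torus.IsSmooth f → Literature.Analysis.FunctionSpaces.Torus.IsDivFree f → Literature.Analysis.FunctionSpaces.Torus.HasZeroMean f → ∀ (c₀ : ℝ) (S : UnitAddTorus (Fin 3) → Fin 3 → EuclideanSpace ℝ (Fin 3)), 0 < c₀ → Literature.Analysis.FunctionSpaces.Torus.IsSmooth S → (∀ x i j, S x i j = S x j i) → (∀ x i j, |S x i j| ≤ c₀ / 10) → (∀ x, Literature.Analysis.FluidPDE.Torus.tensorDivergence S x = f x) → ∀ (φ₀ Θ : ℝ), 0 < φ₀ → ∃ c : ℝ, 0 < c ∧ ∃ ν₀ : ℝ, 0 < ν₀ ∧ ∀ (ν θ : ℝ) (N : ℕ) (W : UnitAddTorus (Fin 3) → EuclideanSpace ℝ (Fin 3)), 0 < ν → ν < ν₀ → |θ| ≤ Θ → Literature.Analysis.FunctionSpaces.Torus.IsDivFree W → Literature.Analysis.FunctionSpaces.Torus.fourierTruncate N W = W → (N : ℝ) ≤ c * ν ^ (-(1 / 2 : ℝ))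 → (∀ x j, ‖Literature.Analysis.FunctionSpaces.Torus.partialDeriv j W x‖ ≤ c * ν⁻¹) → ∃ u : UnitAddTorus (Fin 3) → EuclideanSpace ℝ (Fin 3), Literature.Analysis.FunctionSpaces.Torus.IsSmooth u ∧ Literature.Analysis.FunctionSpaces.Torus.IsDivFree u ∧ Literature.Analysis.FunctionSpaces.Torus.HasZeroMean u ∧ Literature.Analysis.FunctionSpaces.Torus.fourierTruncate N u = 0 ∧ MeasureTheory.integral MeasureTheory.volume (fun x => ‖u x‖ ^ 2) = 3 * c₀ + MeasureTheory.integral MeasureTheory.volume (fun x => ∑ i, S x i i) ∧ ν * Literature.Analysis.FunctionSpaces.Torus.gradNormSq u + MeasureTheory.integral MeasureTheory.volume (fun x => inner ℝ (-(Literature.Analysis.FunctionSpaces.Torus.convect u u x) + ν • Literature.Analysis.FunctionSpaces.Torus.laplacian u x + f x) (W x + (2 * θ) • u x)) < φ₀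

/-- item stmt-AnomalousDissipation-1240 · crux · rank 2 · closed · moot by None · by planner
why it might fail: O(K/n²) rate unpublished (DLS09 Prop 2.2: no rate): needs |ζ_x|₂≥2, ζ_x≠±ζ_x′ over all 15 Nash directions and amplitudes truncated at D≤n/4, so every cross term of u⊗u sits at |k|₂≥n/2>m; a violated constraint leaves an O(K/n) or non-oscillating term and the ∀m≤n/8 ∀W clause fails. Audit: none seen.
sources: arXiv:math/0702079 Prop. 2.2 + §3 Prop. 3.2 (localized div-free plane waves via potentials; qualitative, no rate) and §4.1 Lemma 4.3 (rank-one segments in the wave cone) — read pp.5-6, 8-9 this pass, CheskidovLuo2022 = arXiv:2009.06596 Lemma 4.2; tree Literature.Analysis.FluidPDE.NashGeometric.{geometric_lemma, decomposition, contDiffOn_coeff, le_coeffSq}: r_3 = 1/10, 15 integer directions e_i, e_i±2e_j, coeff smooth on the OPEN sup-ball B(Id,1/5) ⊃ B̄(Id,1/10) ∋ Id+S/c₀, tree Literature.Analysis.FunctionSpaces.Torus.{freqBall (ℓ² ball: mem_freqBall), fourierTruncate, mFourierCoeff_realTrigPoly_eq_zero, integral_inner_realTrigPoly_right, isDivFree_realTrigPoly,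 partialDeriv_realTrigPoly} (RobinsonRodrigoSadowski2016 §4.1), BuckmasterEtAl2018 §2.1: tree Literature.Analysis.FluidPDE.Torus.tensorDivergence (column convention (div S)_i = Σ_j ∂_j S_ij) — the c₀Id part pairs to c₀∫div W = 0
[crux] Quantitative De Lellis–Székelyhidi bath on T³ in near-identity Nash form. Given c₀>0 and a
smooth symmetric tensor S (columns S x j; |S_ij| ≤ c₀/10): ∃ C ∀ n ≥ 1 ∃ u smooth div-free mean-zero
with NO Fourier modes |k| ≤ n (fourierTruncate n u = 0), energy EXACTLY ∫‖u‖² = 3c₀ + ∫tr S (= ∫ tr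
R, R := c₀Id + S), ‖∇u‖² ≤ C n², and stress defect |∫(u⊗u):∇W − ∫S:∇W| ≤ C K/n² for every div-free W
of degree ≤ m, 8m ≤ n, sup‖∂_jW‖ ≤ K (the c₀Id part pairs to c₀∫div W = 0). Recipe: R/c₀ = Id + S/c₀
lies in the sup-ball of radius 1/10 = NashGeometric.radius (Fin 3), so R = Σ_x a_x² dir_x⊗dir_x with
a_x = √c₀·coeff_x(Id + S/c₀) smooth (tree:
Literature.Analysis.FluidPDE.NashGeometric.geometric_lemma, 15 integer directions dir_x); pick ζ_x ∈
ℤ³ ⊥ dir_x with |ζ_x| ≥ 2, pairwise ζ_x ≠ ±ζ_x'; ã_x := T_D a_x, D = ⌊n/4⌋; u := λ·√2 Σ_x curl(ã_x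
(dir_x × ζ_x)/(2πn|ζ_x|²) sin(2πnζ_x·y)) = λ√2 Σ_x [ã_x cos(2πnζ_x·y) dir_x + O(∇ã_x/n)], λ = 1 +
O(n⁻²) the energy normalisation. All modes lie in ±nζ_x + freqBall D (|k| ≥ 2n − n/4 > n); against
degree ≤ 2D + m < n products every oscillatory term (frequencies n(ζ_x ± ζ_x'), 2nζ_x) integrates to
EXACTLY 0, leaving R_D := Σ ã_x² dir⊗dir (‖R_D − R‖_∞ = O -/
@[route_item "route-AnomalousDissipation-TaylorResolutionBarrier"]
def DivFreeBath : Prop :=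
  ∀ (c₀ : ℝ) (S : UnitAddTorus (Fin 3) → Fin 3 → EuclideanSpace ℝ (Fin 3)), 0 < c₀ → Literature.Analysis.FunctionSpaces.Torus.IsSmooth S → (∀ x i j, S x i j = S x j i) → (∀ x i j, |S x i j| ≤ c₀ / 10) → ∃ C : ℝ, ∀ n : ℕ, 1 ≤ n → ∃ u : UnitAddTorus (Fin 3) → EuclideanSpace ℝ (Fin 3), Literature.Analysis.FunctionSpaces.Torus.IsSmooth u ∧ Literature.Analysis.FunctionSpaces.Torus.IsDivFree u ∧ Literature.Analysis.FunctionSpaces.Torus.HasZeroMean u ∧ Literature.Analysis.FunctionSpaces.Torus.fourierTruncate n u = 0 ∧ MeasureTheory.integral MeasureTheory.volume (fun x => ‖u x‖ ^ 2) = 3 * c₀ + MeasureTheory.integral MeasureTheory.volume (fun x => ∑ i, S x i i) ∧ Literature.Analysis.FunctionSpaces.Torus.gradNormSq u ≤ C * (n : ℝ) ^ 2 ∧ ∀ (m : ℕ) (K : ℝ) (W : UnitAddTorus (Fin 3) → EuclideanSpace ℝ (Fin 3)), 8 * m ≤ n → Literature.Analysis.FunctionSpaces.Torus.IsDivFree W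 → Literature.Analysis.FunctionSpaces.Torus.fourierTruncate m W = W → (∀ x j, ‖Literature.Analysis.FunctionSpaces.Torus.partialDeriv j W x‖ ≤ K) → |MeasureTheory.integral MeasureTheory.volume (fun x => ∑ j, (inner ℝ (u x) (Literature.Analysis.FunctionSpaces.Torus.partialDeriv j W x) * u x j - inner ℝ (S x j) (Literature.Analysis.FunctionSpaces.Torus.partialDeriv j W x)))| ≤ C * K / (n : ℝ) ^ 2

/-- item stmt-AnomalousDissipation-1241 · support · rank 3 · closed · moot by None · by planner
why it might fail: An identity; it fails only through conventions — Torus.convect u u = Du[u] vs (u·∇)u, the sign of Torus.laplacian, Bochner junk (all fields are smooth here) — or if fourierTruncate N u = 0 did not force û = 0 on freqBall N (it does: mFourierCoeff_realTrigPoly).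
sources: FoiasManleyRosaTemam2001 App. A (A.33)-(A.34), PDF p.114 (b(u,v,v)=0, b(u,v,w) = −b(u,w,v)); read this pass, tree (all PROVED): Literature.Analysis.FunctionSpaces.Torus.integral_inner_convect_self_eq_zero, Torus.integral_inner_convect_eq_neg (Temam Ch.II Lemma 1.3), Torus.integral_inner_laplacian_eq_neg_holds (Evans App. C.2), Literature.Analysis.FluidPDE.Torus.integral_inner_tensorDivergence, RobinsonRodrigoSadowski2016 §4.1; tree TorusTrigPoly: integral_inner_realTrigPoly_right + mFourierCoeff_realTrigPoly_eq_zero (⟪Δu,W⟫ = 0 by disjoint Fourier supports)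
[crux] The certificate left-hand side at a bath state is explicit. For S smooth with div S = f
(columns), W div-free of degree ≤ N (fourierTruncate N W = W), u smooth div-free with
fourierTruncate N u = 0, and reals ν, θ: ν‖∇u‖² + ∫⟪−(u·∇)u + νΔu + f, W + 2θu⟫ = (1−2θ)ν‖∇u‖² +
∫Σ_j(⟪u,∂_jW⟫u_j − ⟪S·j,∂_jW⟫) + 2θ∫⟪f,u⟫. Ingredients: ∫⟪(u·∇)u,u⟫ = 0 and ∫⟪(u·∇)u,W⟫ = −∫(u⊗u):∇W
(div u = 0, IBP on T³); ∫⟪Δu,u⟫ = −‖∇u‖²; ∫⟪Δu,W⟫ = 0 by disjoint Fourier supports (Parseval;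
coefficient uniqueness for realTrigPoly turns fourierTruncate N u = 0 into û(k) = 0 on freqBall N);
∫⟪f,W⟫ = ∫⟪div S,W⟫ = −∫Σ_j⟪S·j,∂_jW⟫ (tree: FluidPDE.Torus.integral_inner_tensorDivergence,
proved). This is where 'the bath cancels the certificate's only lever (f,W) exactly' lives. -/
@[route_item "route-AnomalousDissipation-TaylorResolutionBarrier"]
def CertificateIdentity : Prop :=
  ∀ (ν θ : ℝ) (N : ℕ) (f W u : UnitAddTorus (Fin 3) → EuclideanSpace ℝ (Fin 3)) (S : UnitAddTorus (Fin 3) → Fin 3 → EuclideanSpace ℝ (Fin 3)), Literature.Analysis.FunctionSpaces.Torus.IsSmooth S → (∀ x, Literature.Analysis.FluidPDE.Torus.tensorDivergence S x = f x) → Literature.Analysis.FunctionSpaces.Torus.IsDivFree W → Literature.Analysis.FunctionSpaces.Torus.fourierTruncate N W = W → Literature.Analysis.FunctionSpaces.Torus.IsSmooth u → Literature.Analysis.FunctionSpaces.Torus.IsDivFree u → Literature.Analysis.FunctionSpaces.Torus.fourierTruncate N u = 0 → ν * Literature.Analysis.FunctionSpaces.Torus.gradNormSq u + MeasureTheory.integral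 MeasureTheory.volume (fun x => inner ℝ (-(Literature.Analysis.FunctionSpaces.Torus.convect u u x) + ν • Literature.Analysis.FunctionSpaces.Torus.laplacian u x + f x) (W x + (2 * θ) • u x)) = (1 - 2 * θ) * ν * Literature.Analysis.FunctionSpaces.Torus.gradNormSq u + MeasureTheory.integral MeasureTheory.volume (fun x => ∑ j, (inner ℝ (u x) (Literature.Analysis.FunctionSpaces.Torus.partialDeriv j W x) * u x j - inner ℝ (S x j) (Literature.Analysis.FunctionSpaces.Torus.partialDeriv j W x))) + 2 * θ * MeasureTheory.integral MeasureTheory.volume (fun x => inner ℝ (f x) (u x))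

/-- item stmt-AnomalousDissipation-1242 · support · rank 9 · closed · moot by None · by planner
sources: DoeringFoias2002 §2, tree Literature/Analysis/FunctionSpaces/TorusInverseLaplacian.lean
[support] The energy window on which the barrier bites: for f smooth div-free mean-zero there is
E₀(f) such that every E ≥ E₀ is the energy of a bath datum (c₀, S) as in TaylorBarrier. Proof: φ :=
Δ⁻¹f componentwise (tree TorusInverseLaplacian), S₀ := ∇φ + (∇φ)ᵀ (columns S₀ x j = ∂_jφ + ∇φ_j);
div S₀ = Δφ + ∇div φ = f (div φ = Δ⁻¹div f = 0), tr S₀ = 2div φ = 0; take S := S₀, c₀ := E/3, valid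
once E ≥ E₀ := 30·sup_{x,i,j}|S₀,ij(x)| (sup finite: smooth on compact T³). The sharp window
(E_rel(f), ∞) of card second-moment-horizon would need Nash's lemma on arbitrary compact subsets of
the PD cone (not in tree) and is not filed. -/
@[route_item "route-AnomalousDissipation-TaylorResolutionBarrier"]
def BathDataAboveThreshold : Prop :=
  ∀ f : UnitAddTorus (Fin 3) → EuclideanSpace ℝ (Fin 3), Literature.Analysis.FunctionSpaces.Torus.IsSmooth f → Literature.Analysis.FunctionSpaces.Torus.IsDivFree f → Literature.Analysis.FunctionSpaces.Torus.HasZeroMean f → ∃ E₀ : ℝ, ∀ E : ℝ, E₀ ≤ E → ∃ (c₀ : ℝ) (S : UnitAddTorus (Fin 3) → Fin 3 → EuclideanSpace ℝ (Fin 3)), 0 < c₀ ∧ Literature.Analysis.FunctionSpaces.Torus.IsSmooth S ∧ (∀ x i j, S x i j = S x j i) ∧ (∀ x i j, |S x i j| ≤ c₀ / 10) ∧ (∀ x, Literature.Analysis.FluidPDE.Torus.tensorDivergence S x = f x) ∧ 3 * c₀ + MeasureTheory.integral MeasureTheory.volume (fun x => ∑ i, S x i i) = E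

/-- item stmt-AnomalousDissipation-1243 · assembly · rank 1 · closed · moot by None · by planner
sources: folder Sketch.lean / NOTES.md §Check (planner-plancard-AnomalousDissipation-Anomalo-d143ac11-0)
[assembly] DivFreeBath → CertificateIdentity → TaylorBarrier (BARRIER ROUTE: the conclusion is the
barrier X, NOT Summit.AnomalousDissipation — declared in the thesis). Bookkeeping: given (f, c₀, S,
φ₀, Θ) take C ≥ 1 from DivFreeBath(c₀,S); choose c' > 0 with (1+2Θ)·C·c'² ≤ φ₀/4; for ν < ν₀ put n
:= ⌊c'ν^{-1/2}⌋ (≥ 1 and ≥ c'ν^{-1/2}/2); c := min(c'/16, φ₀c'²/(16C)). Then N ≤ cν^{-1/2} gives 8N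
≤ n; u from DivFreeBath(n) has fourierTruncate N u = 0 (freqBall N ⊆ freqBall n + coefficient
uniqueness), energy E', and by CertificateIdentity LHS = (1−2θ)ν‖∇u‖² + defect + 2θ(f,u) with
|(1−2θ)ν‖∇u‖²| ≤ (1+2Θ)νCn² ≤ φ₀/4, |defect| ≤ CK/n² ≤ 4Cc/c'² ≤ φ₀/4 (K = cν⁻¹), and |2θ(f,u)| =
2|θ||(f − T_n f, u)| ≤ 2Θ‖f − T_n f‖₂√E' < φ₀/4 once ν₀ is small (tree:
tendsto_eLpNorm_fourierTruncate_sub, integral_inner_fourierTruncate_left). Total < φ₀. -/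
@[route_item "route-AnomalousDissipation-TaylorResolutionBarrier"]
def Assembly : Prop :=
  DivFreeBath → CertificateIdentity → TaylorBarrier

end Summit.AnomalousDissipation.AnomalousDissipation.Theses.TaylorResolutionBarrier
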